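import Literature.AlgebraicGeometry.Resolution.WeightedCentreMonomialCurve
import Literature.AlgebraicGeometry.Resolution.WeightedCentreFirstOrder
import Literature.AlgebraicGeometry.Resolution.WeightedCentreHeavyTaylor
import HarnessLib

/-!
# THEOREM RZ, the `(E_p)` step: the top block is a derivation killing the `Z`-free part of `g`
# (instrument for engine 1's `W(f)` toy model, NOT a resolution theorem)

Engine 1 of the RESOLUTION OBSERVATORY toy model `W(f)` (RE-DERIVATION-eng1-g41 §3.7.4 THEOREM RZ, paragraph
"`(E_p)`: `Ψ_{p,0} + Ψ_{0,1} = 0`, i.e. `Δ^{(p)}_{P₁} g + D g = 0` with `D := Σ_x P_{p,x} ∂_x`.  `Δ^{(p)}_{P₁} g` has `Z`-weight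
`≥ p d₁ > d*`, and the `Z`-weight-`d*` component of `D g` is `D* ḡ` …"; CARVER-NOTES-eng1-g42 T92).  After the reduction
`P = σP₁ + σ^pP_p` (`WeightedCentreRZReduction`) the isotropy equation is `g(x + σP₁ + σ^pP_p) = g`: a shift along the monomial
curve `(λ, μ) = (σ, σ^p)` (`MonomialCurve.multiShift` / `orderShift`, `WeightedCentreMonomialCurve`), whose identity `(E_p)` is
`MonomialCurve.coeff_add_coeff_eq_zero_of_diag_eq_C` and whose `μ`-coefficient is the first-order term `Σ_x P_{p,x} ∂_x g`
(`FirstOrder.coeff_single_one_aeval_add_sum`, `WeightedCentreFirstOrder`).  This file takes the `Z`-weight-`d*` component: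

* `RZFirstOrder.weightedHomogeneousComponent_sum_mul_pderiv` — GRADED FIRST-ORDER TERM (ours, `ℕ`-valued weights `zw`): if every
  monomial of `u_j` weighs `≥ zw j + d*`, the weight-`d*` component of `Σ_j u_j ∂_j G` is `Σ_j u_j^{lead} ∂_j Ḡ`, `u^{lead}_j` the
  weight-`(zw j + d*)` component and `Ḡ` the weight-`0` component of `G` (differentiating in `x_j` lowers the weight by `zw j`);
* `RZFirstOrder.sum_leading_mul_pderiv_eq_zero` — THE `(E_p)` STEP: in the data conventions of `WeightedCentreRZEndgame`
  (`(★) d* < p d₁`, the two columns `v 0 = P₁`, `v 1 = P_p` weighing `≥ zw j + d₁`, resp. `≥ zw j + d*`, and a ring endomorphism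
  `Φ` acting as the shift along `(σ, σ^p)` and fixing `C G`):  `Σ_j P_{p,j}^{lead} · ∂_j Ḡ = 0` — "`D* ḡ = 0`"; reading off the
  `ε_Z^γ`-coefficients (`ḡ` is `Z`-free) gives the engine's `∂_{θ_γ} ḡ = 0`, typed as `coeff_sum_leading_mul_pderiv_eq_zero`.

References: Taylor expansion, first-order terms and graded leading forms [Lang2002, Ch. IV §1; Matsumura1987, §27 (p. 207)]; the
weighted frame [AbramovichTemkinWlodarczyk2024, §5.1 (p. 1575)].  All statements are OURS (toy-model bookkeeping) — instruments for
engine 1's `W(f)` model, NOT resolution theorems.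
-/

namespace Literature.AlgebraicGeometry.Resolution.WeightedBlowup

namespace RZFirstOrder

open MvPolynomial

section Graded

variable {K : Type*} [CommRing K] {ι : Type*} [DecidableEq ι] (zw : ι → ℕ)

/-- A monomial of `∂_j F` comes from a monomial of `F` one step up in `x_j` (ours, bookkeeping; `HeavyTaylor.coeff_pderiv_eq`).
[cite: Lang2002, Ch. IV §1] -/
theorem add_single_mem_support_of_mem_support_pderiv (j : ι) (F : MvPolynomial ι K) {m : ι →₀ ℕ}
    (hm : m ∈ (pderiv j F).support) : m + Finsupp.single j 1 ∈ F.support := by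
  have hc := mem_support_iff.mp hm
  rw [coeff_pderiv_eq] at hc
  exact mem_support_iff.mpr fun h0 => hc (by rw [h0, mul_zero])

omit [DecidableEq ι] in
/-- The weight of `m + e_j` (ours, bookkeeping). [cite: Lang2002, Ch. IV §1] -/
theorem weight_add_single (m : ι →₀ ℕ) (j : ι) :
    Finsupp.weight zw (m + Finsupp.single j 1) = Finsupp.weight zw m + zw j := by
  rw [map_add, Finsupp.weight_single, one_smul]

/-- A weighted homogeneous component of a product vanishes when no pair of monomials has the right total weight (ours,
bookkeeping). [cite: Lang2002, Ch. IV §1] -/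
theorem weightedHomogeneousComponent_mul_eq_zero {n : ℕ} {f g : MvPolynomial ι K}
    (h : ∀ a ∈ f.support, ∀ b ∈ g.support, Finsupp.weight zw (a + b) ≠ n) :
    weightedHomogeneousComponent zw n (f * g) = 0 := by
  refine weightedHomogeneousComponent_eq_zero' n _ fun d hd => ?_
  obtain ⟨a, ha, b, hb, rfl⟩ := Finset.mem_add.mp (support_mul f g hd)
  exact h a ha b hb

/-- **Graded first-order term** (ours): with `ℕ`-valued weights `zw`, if every monomial of `u_j` weighs `≥ zw j + d*` then the
weight-`d*` component of the first-order term `Σ_j u_j · ∂_j G` is `Σ_j u_j^{lead} · ∂_j Ḡ`, where `u_j^{lead}` is the weight-`(zw j + d*)`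
component of `u_j` and `Ḡ` the weight-`0` component of `G`.  [cite: Lang2002, Ch. IV §1; Matsumura1987, §27 (p. 207)] -/
theorem weightedHomogeneousComponent_sum_mul_pderiv [Fintype ι] {dstar : ℕ} (u : ι → MvPolynomial ι K)
    (hu : ∀ j, ∀ m ∈ (u j).support, zw j + dstar ≤ Finsupp.weight zw m) (G : MvPolynomial ι K) :
    weightedHomogeneousComponent zw dstar (∑ j, u j * pderiv j G)
      = ∑ j, weightedHomogeneousComponent zw (zw j + dstar) (u j) * pderiv j (weightedHomogeneousComponent zw 0 G) := by
  set Gbar := weightedHomogeneousComponent zw 0 G with hGbar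
  have hsplit : ∀ j, u j * pderiv j G
      = weightedHomogeneousComponent zw (zw j + dstar) (u j) * pderiv j Gbar
        + (weightedHomogeneousComponent zw (zw j + dstar) (u j) * pderiv j (G - Gbar)
          + (u j - weightedHomogeneousComponent zw (zw j + dstar) (u j)) * pderiv j G) := by
    intro j
    rw [map_sub]
    ring
  -- (1) the leading term is homogeneous of weight `d*`
  have hlead : ∀ j, IsWeightedHomogeneous zw
      (weightedHomogeneousComponent zw (zw j + dstar) (u j) * pderiv j Gbar) dstar := by
    intro j d hd
    obtain ⟨a, ha, b, hb, rfl⟩ := Finset.mem_add.mp (support_mul _ _ (mem_support_iff.mpr hd))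
    have hwa : Finsupp.weight zw a = zw j + dstar :=
      weightedHomogeneousComponent_isWeightedHomogeneous (zw j + dstar) (u j) (mem_support_iff.mp ha)
    have hb' := add_single_mem_support_of_mem_support_pderiv j Gbar hb
    have hwb : Finsupp.weight zw (b + Finsupp.single j 1) = 0 :=
      weightedHomogeneousComponent_isWeightedHomogeneous 0 G (mem_support_iff.mp hb')
    rw [weight_add_single] at hwb
    rw [map_add, hwa]
    omega
  -- (2) the two error terms have no monomial of weight `d*`
  have herr₁ : ∀ j, weightedHomogeneousComponent zw dstar
      (weightedHomogeneousComponent zw (zw j + dstar) (u j) * pderiv j (G - Gbar)) = 0 := by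
    intro j
    refine weightedHomogeneousComponent_mul_eq_zero zw fun a ha b hb => ?_
    have hwa : Finsupp.weight zw a = zw j + dstar :=
      weightedHomogeneousComponent_isWeightedHomogeneous (zw j + dstar) (u j) (mem_support_iff.mp ha)
    have hb' := add_single_mem_support_of_mem_support_pderiv j (G - Gbar) hb
    have hne : Finsupp.weight zw (b + Finsupp.single j 1) ≠ 0 := by
      intro h0
      have hc := mem_support_iff.mp hb'
      rw [coeff_sub, hGbar, coeff_weightedHomogeneousComponent, if_pos h0, sub_self] at hc
      exact hc rfl
    rw [weight_add_single] at hne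
    rw [map_add, hwa]
    omega
  have herr₂ : ∀ j, weightedHomogeneousComponent zw dstar
      ((u j - weightedHomogeneousComponent zw (zw j + dstar) (u j)) * pderiv j G) = 0 := by
    intro j
    refine weightedHomogeneousComponent_mul_eq_zero zw fun a ha b hb => ?_
    have hca := mem_support_iff.mp ha
    rw [coeff_sub, coeff_weightedHomogeneousComponent] at hca
    have hwa : zw j + dstar < Finsupp.weight zw a := by
      by_cases h : Finsupp.weight zw a = zw j + dstar
      · rw [if_pos h, sub_self] at hca
        exact absurd rfl hca
      · rw [if_neg h, sub_zero] at hca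
        exact lt_of_le_of_ne (hu j a (mem_support_iff.mpr hca)) (Ne.symm h)
    have hb' := add_single_mem_support_of_mem_support_pderiv j G hb
    have hwb := weight_add_single zw b j
    rw [map_add]
    omega
  -- (3) assemble
  simp_rw [hsplit]
  rw [Finset.sum_add_distrib, map_add, map_sum, map_sum]
  simp_rw [map_add, herr₁, herr₂, add_zero, Finset.sum_const_zero, add_zero]
  exact Finset.sum_congr rfl fun j _ => (hlead j).weightedHomogeneousComponent_same

end Graded

section Ep

variable {K : Type*} [CommRing K] {ι : Type*} [Fintype ι] [DecidableEq ι]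

/-- **THEOREM RZ, the `(E_p)` step: `D* ḡ = 0`** (ours; RE-DERIVATION-eng1-g41 §3.7.4).  DATA as in `RZEndgame.eq_zero_of_isotropy`:
`ℕ`-valued `Z`-weights `zw`, `(★) d* < p·d₁`, the two columns `v 0 = P₁` (monomials weighing `≥ zw j + d₁`) and `v 1 = P_p`
(`≥ zw j + d*`), a ring endomorphism `Φ` of `(MvPolynomial ι K)[X]` fixing `K`, acting on the slots by the shift along the curve
`(σ, σ^p)` and fixing `C G` (the isotropy `g(x + σP₁ + σ^pP_p) = g`).  CONCLUSION: `Σ_j P_{p,j}^{lead} · ∂_j Ḡ = 0`, where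
`P_{p,j}^{lead}` is the weight-`(zw j + d*)` component of `P_{p,j}` and `Ḡ` the weight-`0` (`Z`-free) component of `G`.
PROOF: `(E_p)` (`MonomialCurve.coeff_add_coeff_eq_zero_of_diag_eq_C`): `Ψ_{(p,0)} + Ψ_{(0,1)} = 0`; `Ψ_{(p,0)}` weighs `≥ p d₁ > d*`
(`MonomialCurve.le_weight_of_mem_support_coeff_multiShift`), `Ψ_{(0,1)} = Σ_j P_{p,j} ∂_j G` (`FirstOrder.coeff_single_one_aeval_add_sum`),
and its weight-`d*` component is `weightedHomogeneousComponent_sum_mul_pderiv`.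
[cite: Lang2002, Ch. IV §1; Matsumura1987, §27 (p. 207); AbramovichTemkinWlodarczyk2024, §5.1 (p. 1575)] -/
theorem sum_leading_mul_pderiv_eq_zero (zw : ι → ℕ) {p d₁ dstar : ℕ} (hp : p ≠ 0) (hstar : dstar < p * d₁)
    (v : Fin 2 → ι → MvPolynomial ι K)
    (hv0 : ∀ j, ∀ m ∈ (v 0 j).support, zw j + d₁ ≤ Finsupp.weight zw m)
    (hv1 : ∀ j, ∀ m ∈ (v 1 j).support, zw j + dstar ≤ Finsupp.weight zw m) {G : MvPolynomial ι K}
    (Φ : Polynomial (MvPolynomial ι K) →+* Polynomial (MvPolynomial ι K))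
    (hC : ∀ a : K, Φ (Polynomial.C (C a)) = Polynomial.C (C a))
    (hX : ∀ j, Φ (Polynomial.C (X j))
      = Polynomial.C (X j) + ∑ t, Polynomial.X ^ (![1, p] : Fin 2 → ℕ) t * Polynomial.C (v t j))
    (hΦ : Φ (Polynomial.C G) = Polynomial.C G) :
    ∑ j, weightedHomogeneousComponent zw (zw j + dstar) (v 1 j) * pderiv j (weightedHomogeneousComponent zw 0 G) = 0 := by
  have hdiag : MonomialCurve.diag ![1, p] (MonomialCurve.multiShift v G) = Polynomial.C G := by
    rw [MonomialCurve.diag_multiShift, ← MonomialCurve.map_C_eq_orderShift ![1, p] v Φ hC hX G, hΦ]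
  have hEp := MonomialCurve.coeff_add_coeff_eq_zero_of_diag_eq_C hp hdiag
  have h01 : coeff (Finsupp.single 1 1) (MonomialCurve.multiShift v G) = ∑ j, v 1 j * pderiv j G :=
    FirstOrder.coeff_single_one_aeval_add_sum v 1 G
  have hp0 : weightedHomogeneousComponent zw dstar (coeff (Finsupp.single 0 p) (MonomialCurve.multiShift v G)) = 0 := by
    refine weightedHomogeneousComponent_eq_zero' dstar _ fun m hm => ne_of_gt ?_
    have h := MonomialCurve.le_weight_of_mem_support_coeff_multiShift hv0 hv1 G _ hm
    simp only [Finsupp.single_eq_same, Finsupp.single_eq_of_ne (show (1 : Fin 2) ≠ 0 by decide), zero_mul,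
      add_zero] at h
    exact lt_of_lt_of_le hstar h
  have key := congrArg (weightedHomogeneousComponent zw dstar) hEp
  rw [map_add, map_zero, hp0, zero_add, h01, weightedHomogeneousComponent_sum_mul_pderiv zw (v 1) hv1 G] at key
  exact key

/-- **… read coefficientwise in `ε_Z`: `∂_{θ_γ} ḡ = 0`** (ours; RE-DERIVATION-eng1-g41 §3.7.4 "`ḡ` is `Z`-free, so `∂_{θ_γ} ḡ = 0` for
every `γ`").  In the setting of `sum_leading_mul_pderiv_eq_zero` suppose moreover that the leading blocks `P_{p,j}^{lead}` are polynomials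
in slots of POSITIVE weight only (the `Z`-slots; engine: RIGID).  Then for every exponent `γ` the constant vector
`θ_γ := ([ε^γ] P_{p,j}^{lead})_j` is killed: `Σ_j θ_{γ,j} · ∂_j Ḡ = 0` — because `Ḡ`, hence each `∂_j Ḡ`, only involves weight-`0` slots,
so the `ε^γ`-part of `Σ_j P^{lead}_{p,j} ∂_j Ḡ` separates.  (For a slot `j` of positive weight `∂_j Ḡ = 0` anyway.)
[cite: Lang2002, Ch. IV §1; Matsumura1987, §27 (p. 207); AbramovichTemkinWlodarczyk2024, §5.1 (p. 1575)] -/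
theorem coeff_sum_leading_mul_pderiv_eq_zero (zw : ι → ℕ) {p d₁ dstar : ℕ} (hp : p ≠ 0) (hstar : dstar < p * d₁)
    (v : Fin 2 → ι → MvPolynomial ι K)
    (hv0 : ∀ j, ∀ m ∈ (v 0 j).support, zw j + d₁ ≤ Finsupp.weight zw m)
    (hv1 : ∀ j, ∀ m ∈ (v 1 j).support, zw j + dstar ≤ Finsupp.weight zw m)
    (hvZ : ∀ j, ∀ i ∈ (v 1 j).vars, 0 < zw i) {G : MvPolynomial ι K}
    (Φ : Polynomial (MvPolynomial ι K) →+* Polynomial (MvPolynomial ι K))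
    (hC : ∀ a : K, Φ (Polynomial.C (C a)) = Polynomial.C (C a))
    (hX : ∀ j, Φ (Polynomial.C (X j))
      = Polynomial.C (X j) + ∑ t, Polynomial.X ^ (![1, p] : Fin 2 → ℕ) t * Polynomial.C (v t j))
    (hΦ : Φ (Polynomial.C G) = Polynomial.C G) (γ m : ι →₀ ℕ) (hm : ∀ i ∈ m.support, zw i = 0) :
    ∑ j, coeff γ (weightedHomogeneousComponent zw (zw j + dstar) (v 1 j))
      * coeff m (pderiv j (weightedHomogeneousComponent zw 0 G)) = 0 := by
  classical
  -- supports: the leading blocks live on positive-weight slots, the derivatives of `Ḡ` on weight-`0` slots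
  have hF : ∀ j (a : ι →₀ ℕ), coeff a (weightedHomogeneousComponent zw (zw j + dstar) (v 1 j)) ≠ 0 →
      ∀ i ∈ a.support, 0 < zw i := by
    intro j a ha i hi
    rw [coeff_weightedHomogeneousComponent] at ha
    split_ifs at ha with hw
    · exact hvZ j i ((mem_vars_iff_mem_support i).mpr ⟨a, mem_support_iff.mpr ha, hi⟩)
    · exact absurd rfl ha
  have hD : ∀ j (b : ι →₀ ℕ), coeff b (pderiv j (weightedHomogeneousComponent zw 0 G)) ≠ 0 →
      ∀ i ∈ b.support, zw i = 0 := by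
    intro j b hb i hi
    have hb' := add_single_mem_support_of_mem_support_pderiv j _ (mem_support_iff.mpr hb)
    have hw : Finsupp.weight zw (b + Finsupp.single j 1) = 0 :=
      weightedHomogeneousComponent_isWeightedHomogeneous 0 G (mem_support_iff.mp hb')
    rw [Finsupp.weight_apply, Finsupp.sum] at hw
    have hi' : i ∈ (b + Finsupp.single j 1).support := Finsupp.support_mono le_self_add hi
    have h0 := (Finset.sum_eq_zero_iff_of_nonneg fun i _ => Nat.zero_le _).mp hw i hi'
    rw [smul_eq_mul, mul_eq_zero] at h0
    exact h0.resolve_left (Finsupp.mem_support_iff.mp hi')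
  by_cases hγ : ∃ i ∈ γ.support, zw i = 0
  · -- `γ` touches a weight-`0` slot: every `[ε^γ] P^{lead}_j` vanishes
    obtain ⟨i, hi, h0⟩ := hγ
    refine Finset.sum_eq_zero fun j _ => ?_
    have hc : coeff γ (weightedHomogeneousComponent zw (zw j + dstar) (v 1 j)) = 0 := by
      by_contra hc
      exact (hF j γ hc i hi).ne' h0
    rw [hc, zero_mul]
  push Not at hγ
  have key := congrArg (coeff (γ + m)) (sum_leading_mul_pderiv_eq_zero zw hp hstar v hv0 hv1 Φ hC hX hΦ)
  rw [coeff_sum, coeff_zero] at key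
  rw [← key]
  refine Finset.sum_congr rfl fun j _ => ?_
  -- the `(γ + m)`-coefficient of `P^{lead}_j · ∂_j Ḡ` is `[ε^γ]P^{lead}_j · [x^m]∂_j Ḡ`: the supports separate slot by slot
  rw [coeff_mul]
  symm
  refine Finset.sum_eq_single (γ, m) (fun ab hab hne => ?_)
    (fun h => absurd (Finset.mem_antidiagonal.mpr (by simp)) h)
  obtain ⟨a, b⟩ := ab
  by_cases ha : coeff a (weightedHomogeneousComponent zw (zw j + dstar) (v 1 j)) = 0
  · rw [ha, zero_mul]
  by_cases hb : coeff b (pderiv j (weightedHomogeneousComponent zw 0 G)) = 0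
  · rw [hb, mul_zero]
  exfalso
  apply hne
  have e : a + b = γ + m := Finset.mem_antidiagonal.mp hab
  have ei : ∀ i, a i + b i = γ i + m i := fun i => by
    simpa only [Finsupp.add_apply] using congrArg (fun f => f i) e
  have hab' : ∀ i, a i = γ i ∧ b i = m i := by
    intro i
    by_cases hzi : zw i = 0
    · have hai : a i = 0 := Finsupp.notMem_support_iff.mp fun h => (hF j a ha i h).ne' hzi
      have hγi : γ i = 0 := Finsupp.notMem_support_iff.mp fun h => hγ i h hzi
      have := ei i
      omega
    · have hbi : b i = 0 := Finsupp.notMem_support_iff.mp fun h => hzi (hD j b hb i h)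
      have hmi : m i = 0 := Finsupp.notMem_support_iff.mp fun h => hzi (hm i h)
      have := ei i
      omega
  exact Prod.ext (Finsupp.ext fun i => (hab' i).1) (Finsupp.ext fun i => (hab' i).2)

end Ep

end RZFirstOrder

end Literature.AlgebraicGeometry.Resolution.WeightedBlowup
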